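import Summits.BirchSwinnertonDyer.BirchSwinnertonDyer.Theorems.ManinLocalTwoThreeGammaOneKatoRoadHolds
import Summits.BirchSwinnertonDyer.BirchSwinnertonDyer.Theorems.ManinLocalTwoThreeGammaOneKatoRoad
import Summits.BirchSwinnertonDyer.BirchSwinnertonDyer.Theorems.ManinLocalTwoThreeKatoShiftTwoPrimeClassPlus
import Summits.BirchSwinnertonDyer.Rank1Residual.ManinAdditive.DegeneracyLoopLaws
import Literature.NumberTheory.EllipticCurves.NewformGaloisRepIntegralityProofs
import HarnessLib

/-!
# Route `ManinLocalTwoThree`, crux C2 `ManinOddAtFour` (stmt-BirchSwinnertonDyer-22967) — NEGATIVE-lane bookkeeping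
# (refuter REF1, §R114 / R-es-53): **E-es-110 `KatoCurve.KatoNeronIntegralTwoGamma1Optimal` is EQUIVALENT, over the
# tree, to E-es-112 `KatoCurve.GammaOneOddAtFour`** (es g24 MEMO-es §38.4(b) audited and sharpened).

es's Γ₁ Kato road (`…Theorems.ManinLocalTwoThreeGammaOneKatoRoad`, p1) proves
`GammaOneOddAtFour ⟸ KatoNeronIntegralTwoGamma1Optimal ∧ TwoAdicGammaOneWitnessLaw`, and p2
(`…GammaOneKatoRoadHolds`) proves `TwoAdicGammaOneWitnessLaw` outright.  This file proves the CONVERSE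
`GammaOneOddAtFour → KatoNeronIntegralTwoGamma1Optimal` by the elementary lattice computation

* `λ_x := {∞, x/m}_f − {∞, 1/m}_f ∈ Λ₁(f)` for units `x` (`Gamma1Lattice.modularSymbol_sub_mem_periodLatticeGamma1`);
* for an EVEN `χ ≠ 1` and real coefficients, `Σ_a χ(a){∞,a/m}_f = Σ_x χ(x)·Re λ_x`
  (`twistedSymbolSum_eq_sum_re_of_even`, `Σ χ = 0`);
* `c₁·λ_x ∈ Λ_V` (the datum's `smul_periodLatticeGamma1_le`, NO optimality needed), so `c₁·Re λ_x ∈ ℤ·Ω(V)/2`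
  (`Gamma1Period.exists_re_eq_int_mul_realPeriodRat_div_two`);
* `Re λ_{−x} = Re λ_x` (`{∞,−r} = conj{∞,r}`), `χ(−x) = χ(x)` and `m` odd pair the summands off, removing the `½`:
  `c₁·Σ_a χ(a){∞,a/m}_f ∈ Ω(V)·ℤ[χ]`;

hence `e_χ·S_χ/Ω(V) ∈ (1/c₁)·ℤ̄`, and `s := |c₁|` is the odd multiplier demanded by `KatoFactTwoAt V D₁.f` when `2 ∤ c₁`.
CONSEQUENCE (`katoNeronIntegralTwoGamma1Optimal_iff_gammaOneOddAtFour`): E-es-110 ⟺ E-es-112 — es's F♯₁ node is a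
COSTUME of the 2-part of Stevens' `c₁ = ±1` in the additive case (C2 skeleton v15 stub 6), not a reduction of it to print.

HONEST FRAMING: nothing here proves E-es-110, E-es-112, `2 ∤ c₁`, Manin's conjecture, the crux C2 or BSD; no new definition,
no named fact, no `sorry`; axioms standard.  The conclusion of every theorem is an implication / equivalence between
obligation nodes (Negative-lane helper: no Theses decl is asserted).
-/

set_option autoImplicit false
set_option linter.dupNamespace false

noncomputable section

open scoped Classical MatrixGroups ModularForm ComplexConjugate BigOperators

open CongruenceSubgroup Complex WeierstrassCurve Literature.NumberTheory.EllipticCurves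
  Literature.NumberTheory.EllipticCurves.ModularForms
open Summit.BirchSwinnertonDyer.Rank1Residual.ManinAdditive
open Summit.BirchSwinnertonDyer.Rank1Residual.ManinAdditive.KatoCurve
open Summit.BirchSwinnertonDyer.BirchSwinnertonDyer.Theorems.ManinLocalTwoThree
open Summit.BirchSwinnertonDyer.BirchSwinnertonDyer.Theorems.ManinLocalTwoThree.GammaOneKatoRoad

namespace Summit.BirchSwinnertonDyer.BirchSwinnertonDyer.Theorems.ManinOddAtFour.Negative

/-! ## §1 Two bookkeeping lemmas -/

/-- A Dirichlet character of ODD order is EVEN (`χ(−1)² = 1` and `χ(−1)^{ord χ} = 1`). [folklore] -/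
theorem even_of_not_two_dvd_orderOf {m : ℕ} (χ : DirichletCharacter ℂ m) (h : ¬ 2 ∣ orderOf χ) :
    χ.Even := by
  rcases χ.even_or_odd with he | ho
  · exact he
  · exfalso
    have hn : orderOf χ ≠ 0 := fun h0 => h (h0 ▸ dvd_zero 2)
    have hodd : Odd (orderOf χ) := Nat.odd_iff.mpr (Nat.two_dvd_ne_zero.mp h)
    have h1 := congrArg (fun ψ : DirichletCharacter ℂ m => ψ (-1)) (pow_orderOf_eq_one χ)
    rw [MulChar.pow_apply' χ hn, ho, hodd.neg_one_pow, MulChar.one_apply (isUnit_one.neg)] at h1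
    norm_num at h1

/-- The symmetrised Euler bracket `∏_{ℓ∥N}(ℓ − a_ℓ(V)χ(ℓ))(ℓ − a_ℓ(V)χ(ℓ)⁻¹)` is an algebraic integer. [folklore] -/
theorem isIntegral_eulerBracket₂ {N m : ℕ} [NeZero m] (V : WeierstrassCurve ℚ) (χ : DirichletCharacter ℂ m) :
    IsIntegral ℤ (∏ ℓ ∈ N.primeFactors with ¬ ℓ ^ 2 ∣ N,
        (((ℓ : ℂ) - (V.LFunction ℓ : ℂ) * χ (ℓ : ZMod m)) *
          ((ℓ : ℂ) - (V.LFunction ℓ : ℂ) * (χ (ℓ : ZMod m))⁻¹))) := by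
  have hzint : ∀ z : ℤ, IsIntegral ℤ (z : ℂ) := fun z => by
    simpa using isIntegral_algebraMap (R := ℤ) (A := ℂ) (x := z)
  have hnint : ∀ n : ℕ, IsIntegral ℤ (n : ℂ) := fun n => by
    simpa using isIntegral_algebraMap (R := ℤ) (A := ℂ) (x := (n : ℤ))
  refine IsIntegral.prod _ fun ℓ _ => ?_
  refine ((hnint ℓ).sub ((hzint _).mul (isIntegral_dirichletCharacter_apply χ _))).mul
    ((hnint ℓ).sub ((hzint _).mul ?_))
  rw [← MulChar.inv_apply_eq_inv']
  exact isIntegral_dirichletCharacter_apply χ⁻¹ _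

/-- Pairing `x ↔ −x` on `ℤ/m`, `m` odd: a function with `h(−x) = h(x)` and `h 0 = 0` sums to TWICE its sum over
the half `{x : x.val < (−x).val}`. [folklore] -/
theorem sum_eq_two_mul_sum_half {m : ℕ} [NeZero m] (hm : Nat.Coprime 2 m) (h : ZMod m → ℂ)
    (hsym : ∀ x, h (-x) = h x) (h0 : h 0 = 0) :
    ∑ x : ZMod m, h x = 2 * ∑ x : ZMod m, (if x.val < (-x).val then h x else 0) := by
  have hsplit : ∀ x : ZMod m, h x = (if x.val < (-x).val then h x else 0) +
      (if (-x).val < x.val then h x else 0) + (if x.val = (-x).val then h x else 0) := by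
    intro x
    rcases lt_trichotomy x.val (-x).val with hlt | heq | hgt
    · rw [if_pos hlt, if_neg (not_lt.mpr hlt.le), if_neg (ne_of_lt hlt)]; ring
    · have hx : x = -x := ZMod.val_injective m heq
      have hx0 : x = 0 := by
        have h2 : (2 : ZMod m) * x = 0 := by rw [two_mul]; nth_rewrite 2 [hx]; exact add_neg_cancel x
        have hu : IsUnit (2 : ZMod m) := by
          have : ((2 : ℕ) : ZMod m) = 2 := by norm_cast
          rw [← this]; exact (ZMod.unitOfCoprime 2 hm).isUnit
        exact (hu.mul_right_eq_zero).mp h2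
      subst hx0
      simp [h0]
    · rw [if_neg (not_lt.mpr hgt.le), if_pos hgt, if_neg (ne_of_gt hgt)]; ring
  have hB : ∑ x : ZMod m, (if (-x).val < x.val then h x else 0) =
      ∑ x : ZMod m, (if x.val < (-x).val then h x else 0) := by
    rw [← Equiv.sum_comp (Equiv.neg (ZMod m)) (fun x => if (-x).val < x.val then h x else 0)]
    refine Finset.sum_congr rfl fun x _ => ?_
    simp only [Equiv.neg_apply, neg_neg, hsym]
  have hC : ∑ x : ZMod m, (if x.val = (-x).val then h x else 0) = 0 := by
    refine Finset.sum_eq_zero fun x _ => ?_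
    split_ifs with heq
    · have hx : x = -x := ZMod.val_injective m heq
      have h2 : (2 : ZMod m) * x = 0 := by rw [two_mul]; nth_rewrite 2 [hx]; exact add_neg_cancel x
      have hu : IsUnit (2 : ZMod m) := by
        have : ((2 : ℕ) : ZMod m) = 2 := by norm_cast
        rw [← this]; exact (ZMod.unitOfCoprime 2 hm).isUnit
      have hx0 : x = 0 := (hu.mul_right_eq_zero).mp h2
      rw [hx0, h0]
    · rfl
  calc ∑ x : ZMod m, h x
      = ∑ x : ZMod m, ((if x.val < (-x).val then h x else 0) +
          (if (-x).val < x.val then h x else 0) + (if x.val = (-x).val then h x else 0)) :=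
        Finset.sum_congr rfl fun x _ => hsplit x
    _ = ∑ x : ZMod m, (if x.val < (-x).val then h x else 0) +
          ∑ x : ZMod m, (if (-x).val < x.val then h x else 0) +
          ∑ x : ZMod m, (if x.val = (-x).val then h x else 0) := by
        rw [Finset.sum_add_distrib, Finset.sum_add_distrib]
    _ = 2 * ∑ x : ZMod m, (if x.val < (-x).val then h x else 0) := by rw [hB, hC]; ring

/-! ## §2 The lattice computation: `2 ∤ c₁ ⟹ KatoFactTwoAt V D₁.f` -/

/-- **`2 ∤ c₁(D₁) ⟹ KatoFactTwoAt V D₁.f`** (no optimality needed): for an even primitive `χ ≠ 1` of conductor `m`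
prime to `2N`, `c₁·Σ_a χ(a){∞,a/m}_f ∈ Ω(V)·ℤ[χ]` (pairing `x ↔ −x` of the `Γ₁(N)`-loops `{∞,x/m} − {∞,1/m}`, whose
`c₁`-multiples lie in the Néron lattice with real parts in `ℤ·Ω(V)/2`), so `|c₁|·ϖ·r = ±e_χ·(c₁ S_χ/Ω(V)) ∈ ℤ̄`. [folklore] -/
theorem katoFactTwoAt_of_not_two_dvd_maninConstant
    (V : WeierstrassCurve ℚ) [V.IsElliptic] [V.IsGloballyMinimal] {N : ℕ} [NeZero N]
    (D₁ : Gamma1ParametrizationData V N) (hc : ¬ (2 : ℤ) ∣ D₁.maninConstant) :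
    KatoFactTwoAt V D₁.f := by
  intro hVf hg hmu m _ hcop χ hprim hne hodd h8 ϖ r hϖ hsum
  -- the data
  have hc2 : ¬ (2 : ℤ) ∣ D₁.c := hc
  have hc0 : D₁.c ≠ 0 := D₁.maninConstant_ne_zero
  have hm0 : m ≠ 0 := NeZero.ne m
  have hm2 : Nat.Coprime 2 m := (Nat.Coprime.coprime_dvd_right (dvd_mul_right 2 N) hcop).symm
  have hNm : N.Coprime m := (Nat.Coprime.coprime_mul_left hcop.symm)
  have hm1 : m ≠ 1 := by
    rintro rfl
    exact hne (DirichletCharacter.level_one χ)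
  haveI : Nontrivial (ZMod m) := ZMod.nontrivial_iff.mpr hm1
  have heven : χ.Even := even_of_not_two_dvd_orderOf χ hodd
  have hreal : ∀ n, (cuspCoeff D₁.f n).im = 0 :=
    cuspCoeff_im_eq_zero_of_coeffField_eq_bot D₁.isNewformOf.coeffField_eq_bot
  have hΩpos : 0 < V.realPeriodRat := KatoCurve.realPeriodRat_pos V
  have hΩfpos : 0 < plusPeriod D₁.f :=
    IsNewform0.plusPeriod_pos_holds D₁.isNewformOf.1 D₁.isNewformOf.coeffField_eq_bot
  -- the plus classes `P x = {∞, x/m} − {∞, 0}` and the base loop value `B = {∞,1/m} − {∞,0}`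
  set P : ZMod m → ℂ := fun x ↦ modularSymbol D₁.f (((x.val : ℕ) : ℚ) / m) - modularSymbol D₁.f 0 with hP
  set B : ℂ := modularSymbol D₁.f ((1 : ℚ) / m) - modularSymbol D₁.f 0 with hB
  -- (1) `S = Σ χ(x) Re P x = Σ χ(x) (Re P x − Re B)`
  have hS : twistedSymbolSum D₁.f χ = ∑ x : ZMod m, χ x * (((P x).re : ℝ) : ℂ) := by
    have h := twistedSymbolSum_eq_sum_re_of_even D₁.f hm0 hreal χ heven hne
    simpa [hP] using h
  have hsumχ : ∑ x : ZMod m, χ x = 0 := MulChar.sum_eq_zero_of_ne_one hne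
  have hS' : twistedSymbolSum D₁.f χ = ∑ x : ZMod m, χ x * ((((P x).re - B.re : ℝ)) : ℂ) := by
    rw [hS]
    have : ∑ x : ZMod m, χ x * ((((P x).re - B.re : ℝ)) : ℂ)
        = ∑ x : ZMod m, χ x * (((P x).re : ℝ) : ℂ) - (∑ x : ZMod m, χ x) * ((B.re : ℝ) : ℂ) := by
      rw [Finset.sum_mul, ← Finset.sum_sub_distrib]
      refine Finset.sum_congr rfl fun x _ => ?_
      push_cast; ring
    rw [this, hsumχ, zero_mul, sub_zero]
  -- (2) for a unit `x`, `{∞,x/m} − {∞,1/m} ∈ Λ₁(f)`, so `c₁ (Re P x − Re B) ∈ ℤ Ω(V)/2`; for a non-unit `χ x = 0`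
  have hk : ∀ x : ZMod m, ∃ k : ℤ,
      χ x * ((((D₁.c : ℝ) * ((P x).re - B.re) : ℝ)) : ℂ) = χ x * ((((k : ℝ) * (V.realPeriodRat / 2) : ℝ)) : ℂ) := by
    intro x
    by_cases hx : IsUnit x
    · have hcopx : (x.val).Coprime m := by
        have := (ZMod.natCast_zmod_val x).symm ▸ hx
        exact (ZMod.isUnit_iff_coprime x.val m).mp (by rw [ZMod.natCast_zmod_val]; exact hx)
      have hmZ : (m : ℤ) ≠ 0 := by exact_mod_cast hm0
      have hb : IsCoprime ((x.val : ℕ) : ℤ) (m : ℤ) := Nat.isCoprime_iff_coprime.mpr hcopx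
      have hb' : IsCoprime (1 : ℤ) (m : ℤ) := isCoprime_one_left
      have hN : IsCoprime (N : ℤ) (m : ℤ) := Nat.isCoprime_iff_coprime.mpr hNm
      have hmem := Gamma1Lattice.modularSymbol_sub_mem_periodLatticeGamma1 D₁.f hmZ hb hb' hN
      have hmem' : P x - B ∈ periodLatticeGamma1 D₁.f := by
        have e : P x - B = modularSymbol D₁.f ((((x.val : ℕ) : ℤ) : ℚ) / (m : ℤ)) -
            modularSymbol D₁.f (((1 : ℤ) : ℚ) / (m : ℤ)) := by
          simp only [hP, hB]; push_cast; ring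
        rw [e]; exact hmem
      have hcz : (D₁.c : ℂ) * (P x - B) ∈ D₁.L.lattice := D₁.smul_periodLatticeGamma1_le _ hmem'
      obtain ⟨k, hk⟩ := Gamma1Period.exists_re_eq_int_mul_realPeriodRat_div_two D₁.L D₁.isNeronLattice hcz
      refine ⟨k, ?_⟩
      rw [Complex.mul_re, Complex.intCast_re, Complex.intCast_im, zero_mul, sub_zero, Complex.sub_re] at hk
      rw [hk]
    · refine ⟨0, ?_⟩
      rw [χ.map_nonunit hx, zero_mul, zero_mul]
  choose k hk using hk
  -- (3) `c₁ S = (Ω(V)/2) Σ χ(x) k x`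
  have hcS : (D₁.c : ℂ) * twistedSymbolSum D₁.f χ =
      ((V.realPeriodRat / 2 : ℝ) : ℂ) * ∑ x : ZMod m, χ x * (k x : ℂ) := by
    rw [hS', Finset.mul_sum, Finset.mul_sum]
    refine Finset.sum_congr rfl fun x _ => ?_
    have := hk x
    calc (D₁.c : ℂ) * (χ x * ((((P x).re - B.re : ℝ)) : ℂ))
        = χ x * ((((D₁.c : ℝ) * ((P x).re - B.re) : ℝ)) : ℂ) := by push_cast; ring
      _ = χ x * ((((k x : ℝ) * (V.realPeriodRat / 2) : ℝ)) : ℂ) := this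
      _ = ((V.realPeriodRat / 2 : ℝ) : ℂ) * (χ x * (k x : ℂ)) := by push_cast; ring
  -- (4) pairing: `Σ χ(x) k x = 2 J'` with `J'` an algebraic integer
  set hfun : ZMod m → ℂ := fun x ↦ χ x * (k x : ℂ) with hhfun
  have hsym : ∀ x, hfun (-x) = hfun x := by
    intro x
    have hχ : χ (-x) = χ x := by rw [← neg_one_mul, map_mul, heven, one_mul]
    have hPx : (P (-x)).re = (P x).re := re_primeClassZMod_neg D₁.f hm0 hreal x
    have h1 := hk x
    have h2 := hk (-x)
    rw [hχ, hPx] at h2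
    -- `χ x k(−x) Ω/2 = χ x k x Ω/2`
    have h3 : χ x * ((((k (-x) : ℝ) * (V.realPeriodRat / 2) : ℝ)) : ℂ) =
        χ x * ((((k x : ℝ) * (V.realPeriodRat / 2) : ℝ)) : ℂ) := by rw [← h2, ← h1]
    have hΩ2 : (((V.realPeriodRat / 2 : ℝ)) : ℂ) ≠ 0 := by
      have : (V.realPeriodRat / 2 : ℝ) ≠ 0 := by positivity
      exact_mod_cast this
    have h4 : (χ x * (k (-x) : ℂ)) * (((V.realPeriodRat / 2 : ℝ)) : ℂ) =
        (χ x * (k x : ℂ)) * (((V.realPeriodRat / 2 : ℝ)) : ℂ) := by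
      have := h3; push_cast at this ⊢; linear_combination this
    simp only [hhfun, hχ]
    exact mul_right_cancel₀ hΩ2 h4
  have h0 : hfun 0 = 0 := by simp [hhfun, MulChar.map_zero]
  have hpair := sum_eq_two_mul_sum_half hm2 hfun hsym h0
  set J' : ℂ := ∑ x : ZMod m, (if x.val < (-x).val then hfun x else 0) with hJ'
  have hJ'int : IsIntegral ℤ J' := by
    refine IsIntegral.sum _ fun x _ => ?_
    split_ifs
    · exact (isIntegral_dirichletCharacter_apply χ x).mul (isIntegral_algebraMap (R := ℤ) (A := ℂ) (x := k x))
    · exact isIntegral_zero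
  have hcS' : (D₁.c : ℂ) * twistedSymbolSum D₁.f χ = (V.realPeriodRat : ℂ) * J' := by
    rw [hcS]
    change ((V.realPeriodRat / 2 : ℝ) : ℂ) * ∑ x : ZMod m, hfun x = _
    rw [hpair]; push_cast; ring
  -- (5) the Euler bracket and the conclusion with `s = |c₁|`
  set e : ℂ := ∏ ℓ ∈ N.primeFactors with ¬ ℓ ^ 2 ∣ N,
      (((ℓ : ℂ) - (V.LFunction ℓ : ℂ) * χ (ℓ : ZMod m)) *
        ((ℓ : ℂ) - (V.LFunction ℓ : ℂ) * (χ (ℓ : ZMod m))⁻¹)) with he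
  have heint : IsIntegral ℤ e := isIntegral_eulerBracket₂ V χ
  refine ⟨D₁.c.natAbs, ?_, ?_⟩
  · intro h2
    exact hc2 (Int.ofNat_dvd_left.mpr h2)
  · have hΩC : (V.realPeriodRat : ℂ) ≠ 0 := by exact_mod_cast hΩpos.ne'
    have hΩfC : ((plusPeriod D₁.f : ℝ) : ℂ) ≠ 0 := by exact_mod_cast hΩfpos.ne'
    have hcC : (D₁.c : ℂ) ≠ 0 := by exact_mod_cast hc0
    have hϖC : ((ϖ : ℚ) : ℂ) * (V.realPeriodRat : ℂ) = ((plusPeriod D₁.f : ℝ) : ℂ) := by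
      have := congrArg (fun t : ℝ => (t : ℂ)) hϖ
      simpa using this
    -- `|c₁| = u c₁` with `u = ±1`
    obtain ⟨u, huC⟩ : ∃ u : ℤ, ((D₁.c.natAbs : ℕ) : ℂ) = (u : ℂ) * (D₁.c : ℂ) := by
      rcases Int.natAbs_eq D₁.c with h | h
      · refine ⟨1, ?_⟩
        rw [← Int.cast_natCast (R := ℂ) D₁.c.natAbs, ← h]; ring
      · refine ⟨-1, ?_⟩
        have h' : ((D₁.c.natAbs : ℕ) : ℤ) = -D₁.c := by linarith
        rw [← Int.cast_natCast (R := ℂ) D₁.c.natAbs, h']; push_cast; ring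
    have key : ((D₁.c.natAbs : ℕ) : ℂ) * ((ϖ : ℚ) : ℂ) * r = (u : ℂ) * (e * J') := by
      have hX : (V.realPeriodRat : ℂ) * ((plusPeriod D₁.f : ℝ) : ℂ) *
          (((D₁.c.natAbs : ℕ) : ℂ) * ((ϖ : ℚ) : ℂ) * r - (u : ℂ) * (e * J')) = 0 := by
        rw [huC]
        linear_combination ((u : ℂ) * (D₁.c : ℂ) * r * ((plusPeriod D₁.f : ℝ) : ℂ)) * hϖC +
          ((u : ℂ) * (D₁.c : ℂ) * ((plusPeriod D₁.f : ℝ) : ℂ)) * hsum.symm +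
          ((u : ℂ) * e * ((plusPeriod D₁.f : ℝ) : ℂ)) * hcS'
      rcases mul_eq_zero.mp hX with h | h
      · exact absurd h (mul_ne_zero hΩC hΩfC)
      · exact sub_eq_zero.mp h
    rw [key]
    exact (isIntegral_algebraMap (R := ℤ) (A := ℂ) (x := u)).mul (heint.mul hJ'int)

/-! ## §3 The equivalence E-es-110 ⟺ E-es-112 -/

/-- **E-es-112 ⟹ E-es-110**: `GammaOneOddAtFour → KatoNeronIntegralTwoGamma1Optimal`. -/
theorem katoNeronIntegralTwoGamma1Optimal_of_gammaOneOddAtFour (h : GammaOneOddAtFour) :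
    KatoNeronIntegralTwoGamma1Optimal := by
  intro V _ _ N _ D₁ hopt hVf hg hmu m _ hcop χ hprim hne hodd h8 ϖ r hϖ hsum
  exact katoFactTwoAt_of_not_two_dvd_maninConstant V D₁ (h V D₁ hopt hg hmu) hVf hg hmu m hcop χ hprim hne hodd h8
    ϖ r hϖ hsum

/-- **E-es-110 ⟺ E-es-112 over the tree** (the forward direction is es's lever `gammaOneOddAtFour_of` fed with p2's
theorem `twoAdicGammaOneWitnessLaw_holds`). -/
theorem katoNeronIntegralTwoGamma1Optimal_iff_gammaOneOddAtFour :
    KatoNeronIntegralTwoGamma1Optimal ↔ GammaOneOddAtFour :=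
  ⟨fun h => gammaOneOddAtFour_of h twoAdicGammaOneWitnessLaw_holds,
    katoNeronIntegralTwoGamma1Optimal_of_gammaOneOddAtFour⟩

end Summit.BirchSwinnertonDyer.BirchSwinnertonDyer.Theorems.ManinOddAtFour.Negative

end
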